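import Literature.NumberTheory.Weil1964.ArchWeilDatumFactorisation
import Literature.Analysis.SegalBargmann.SchwartzTensorOperators
import Literature.NumberTheory.Automorphic.UnitaryGroupDirectSum
import Literature.Analysis.SegalBargmann.SchwartzTensorStrongContinuity
import HarnessLib

/-!
# Literature / NumberTheory / Weil1964 — the external tensor product of two archimedean Weil data

Weil, *Sur certains groupes d'opérateurs unitaires*, Acta Math. 111 (1964), Chap. I n° 12–13, pp. 160–163 (the
standard representation of a product `G₁ × G₂` of groups of the type considered is the tensor product of the standard
representations) and Chap. III n° 37–38, pp. 188–190 (the product over the places); Folland, *Harmonic Analysis in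
Phase Space* (1989), Prop. (1.43), §1.7 and (4.23).

Given two archimedean Weil data (`IsArchWeilDatum`, `ArchWeilDatum.lean`) `(ι𝕎₁, ω₁)` of `G₁` on `𝓢(ℝ^{σ₁})` and
`(ι𝕎₂, ω₂)` of `G₂` on `𝓢(ℝ^{σ₂})`, both with continuous operators, this file CONSTRUCTS

* §1 **`spBlock : Sp(ℝ^{σ₁} × ℝ^{σ₁}) × Sp(ℝ^{σ₂} × ℝ^{σ₂}) →* Sp(ℝ^{σ₁ ⊕ σ₂} × ℝ^{σ₁ ⊕ σ₂})`**, the block sum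
  `(g₁, g₂) ↦ g₁ ⊕ g₂` for the dot pairings (the tree's `UnitaryGroup.spSumHom`, shown to preserve
  `polar (dotPairing _)`), acting on phase space by `blockPhase` (`coe_spBlock_apply`);
* §2 **`tensorRep ω₁ hc₁ ω₂ hc₂ : Representation ℂ (G₁ × G₂) 𝓢(ℝ^{σ₁ ⊕ σ₂})`**, `(g₁, g₂) ↦ ω₁ g₁ ⊠̂ ω₂ g₂` — the
  tree's CONSTRUCTED operator tensor product `tensorOp` (`SchwartzTensorOperators`) of the two operators — with the
  exact factorisation on pure tensors **`tensorRep_apply_tensorPi : ω(g₁, g₂) (Φ₁ ⊠ Φ₂) = ω₁ g₁ Φ₁ ⊠ ω₂ g₂ Φ₂`**;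
* §3 (w2) **Heisenberg covariance of `tensorRep` over `spBlock ∘ (ι𝕎₁ × ι𝕎₂)`** (`tensorOp_rhoS`);
* §4 (w2′) **unitarity**: `⟪ω(g) F, ω(g) G⟫_{L²} = ⟪F, G⟫_{L²}` on `𝓢(ℝ^{σ₁ ⊕ σ₂})` — on pure tensors by
  `⟪f ⊠ g, f' ⊠ g'⟫ = ⟪f, f'⟫ ⟪g, g'⟫` (Fubini) and the unitary lifts of the factors, in general by two density passes
  (`clm_eq_of_eq_on_tensorPi`) — hence (Mathlib's `LinearEquiv.extendOfIsometry` along the dense `toL2`) every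
  `ω(g)` is the restriction of a unitary operator of `L²(ℝ^{σ₁ ⊕ σ₂})` (`exists_lift_tensorRep`);
* §5 the datum: **`IsArchWeilDatum.tensor_of_continuous`** — (w2) and (w2′) proved here, (w1) (strong continuity of
  the orbit maps `g ↦ ω(g) F` into `𝓢`) as the explicit hypothesis `h1`, any topological groups — and
  **`IsArchWeilDatum.tensor`**, unconditional for locally compact `G₁`, `G₂` (e.g. Lie groups): (w1) is the
  interface-free Schwartz-level theorem `Literature.Analysis.SegalBargmann.continuous_tensorOp_apply` of
  `SchwartzTensorStrongContinuity.lean` (strong continuity of `g ↦ (A₁(g₁) ⊠̂ A₂(g₂)) F` from that of the factors).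

No axioms, no `sorry`; every operator is constructed (no implementer is postulated).

References: [cite: Weil1964, Chap. I n° 12–13, pp. 160–163; Chap. III n° 37–38, pp. 188–190];
[cite: Folland1989, Prop. (1.43), §1.7, (4.23)].

## Provenance

LEAN-IN-TREE rule (2026-08-18), pub-hodgecm model-construction sub-cell, lineage mc-theta-1 gen 10 (RUN-36+ material
for residual (a)(iii) of the archimedean read-off: the external tensor product of archimedean Weil data).
-/

set_option autoImplicit false

noncomputable section

open MeasureTheory Complex SchwartzMap Filter Topology
open scoped InnerProductSpace ComplexConjugate Real

namespace Literature.NumberTheory.Weil1964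

open Literature.Analysis.SegalBargmann Literature.RepresentationTheory.HeisenbergGroup
open Literature.NumberTheory.Automorphic

local notation "L2R" σ => Lp ℂ 2 (volume : Measure (σ → ℝ))
local notation "SR" σ => SchwartzMap (σ → ℝ) ℂ
local notation "PV" σ => (σ → ℝ) × (σ → ℝ)
local notation "SpR" σ => symplecticGroup (polar (dotPairing σ))

variable {σ₁ σ₂ : Type*} [Fintype σ₁] [Fintype σ₂] [DecidableEq σ₁] [DecidableEq σ₂]

/-! ## §1 The block sum of symplectic groups for the dot pairings -/

section SpBlock

omit [DecidableEq σ₁] [DecidableEq σ₂] in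
/-- `x ⬝ᵥ y` on `σ₁ ⊕ σ₂` splits into the two blocks. [folklore] -/
theorem dotProduct_eq_inl_add_inr (a b : σ₁ ⊕ σ₂ → ℝ) :
    a ⬝ᵥ b = (a ∘ Sum.inl) ⬝ᵥ (b ∘ Sum.inl) + (a ∘ Sum.inr) ⬝ᵥ (b ∘ Sum.inr) := by
  simp only [dotProduct, Fintype.sum_sum_type, Function.comp_apply]

omit [DecidableEq σ₁] [DecidableEq σ₂] in
/-- **The block sum of two symplectic automorphisms (dot pairings) is symplectic.** [cite: Weil1964, Chap. I n° 12, p. 160] -/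
theorem spSumEquiv_mem_dotPairing {g₁ : (PV σ₁) ≃ₗ[ℝ] PV σ₁} {g₂ : (PV σ₂) ≃ₗ[ℝ] PV σ₂}
    (hg₁ : g₁ ∈ SpR σ₁) (hg₂ : g₂ ∈ SpR σ₂) :
    UnitaryGroup.spSumEquiv g₁ g₂ ∈ SpR (σ₁ ⊕ σ₂) := by
  rw [mem_symplecticGroup] at hg₁ hg₂ ⊢
  intro v w
  have h1 := hg₁ (v.1 ∘ Sum.inl, v.2 ∘ Sum.inl) (w.1 ∘ Sum.inl, w.2 ∘ Sum.inl)
  have h2 := hg₂ (v.1 ∘ Sum.inr, v.2 ∘ Sum.inr) (w.1 ∘ Sum.inr, w.2 ∘ Sum.inr)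
  simp only [polar_apply, dotPairing_apply] at h1 h2
  simp only [polar_apply, dotPairing_apply, UnitaryGroup.spSumEquiv_apply, sumElim_dotProduct_sumElim,
    dotProduct_eq_inl_add_inr v.1 w.2, dotProduct_eq_inl_add_inr w.1 v.2]
  linear_combination h1 + h2

/-- **`spBlock : Sp(W_{σ₁}) × Sp(W_{σ₂}) →* Sp(W_{σ₁ ⊕ σ₂})`, `(g₁, g₂) ↦ g₁ ⊕ g₂`** (dot pairings).
[cite: Weil1964, Chap. I n° 12, p. 160] -/
def spBlock : (SpR σ₁) × (SpR σ₂) →* SpR (σ₁ ⊕ σ₂) :=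
  (UnitaryGroup.spSumHom.comp ((SpR σ₁).subtype.prodMap (SpR σ₂).subtype)).codRestrict _
    fun g => spSumEquiv_mem_dotPairing g.1.2 g.2.2

omit [DecidableEq σ₁] [DecidableEq σ₂] in
/-- `spBlock g` is the block sum `spSumEquiv g₁ g₂`. [folklore] -/
@[simp] theorem coe_spBlock (g : (SpR σ₁) × (SpR σ₂)) :
    ((spBlock g : SpR (σ₁ ⊕ σ₂)) : (PV (σ₁ ⊕ σ₂)) ≃ₗ[ℝ] PV (σ₁ ⊕ σ₂)) =
      UnitaryGroup.spSumEquiv (g.1 : (PV σ₁) ≃ₗ[ℝ] PV σ₁) (g.2 : (PV σ₂) ≃ₗ[ℝ] PV σ₂) := rfl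

omit [DecidableEq σ₁] [DecidableEq σ₂] in
/-- **`spBlock g` acts on phase space by `blockPhase`** of the two factors. [folklore] -/
theorem coe_spBlock_apply (g : (SpR σ₁) × (SpR σ₂)) :
    (⇑((spBlock g : SpR (σ₁ ⊕ σ₂)) : (PV (σ₁ ⊕ σ₂)) ≃ₗ[ℝ] PV (σ₁ ⊕ σ₂)) :
        (PV (σ₁ ⊕ σ₂)) → PV (σ₁ ⊕ σ₂)) =
      blockPhase (⇑(g.1 : (PV σ₁) ≃ₗ[ℝ] PV σ₁)) (⇑(g.2 : (PV σ₂) ≃ₗ[ℝ] PV σ₂)) := rfl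

end SpBlock

/-! ## §2 The tensor product representation -/

section TensorRep

variable {G₁ G₂ : Type*} [Group G₁] [Group G₂]

/-- the operator `ω g` as a continuous linear map is the identity at `g = 1`. [folklore] -/
theorem coe_repCLE_one {σ : Type*} [Fintype σ] {G : Type*} [Group G] (ω : Representation ℂ G (SR σ))
    (hc : ∀ g, Continuous (ω g)) :
    (repCLE ω hc 1 : (SR σ) →L[ℂ] SR σ) = ContinuousLinearMap.id ℂ (SR σ) :=
  ContinuousLinearMap.ext fun f => by rw [coe_repCLE_apply, map_one, ContinuousLinearMap.id_apply]; rfl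

/-- the operators `ω g` as continuous linear maps compose. [folklore] -/
theorem coe_repCLE_mul {σ : Type*} [Fintype σ] {G : Type*} [Group G] (ω : Representation ℂ G (SR σ))
    (hc : ∀ g, Continuous (ω g)) (g g' : G) :
    (repCLE ω hc (g * g') : (SR σ) →L[ℂ] SR σ) =
      (repCLE ω hc g : (SR σ) →L[ℂ] SR σ).comp (repCLE ω hc g' : (SR σ) →L[ℂ] SR σ) :=
  ContinuousLinearMap.ext fun f => by
    rw [ContinuousLinearMap.comp_apply, coe_repCLE_apply, coe_repCLE_apply, coe_repCLE_apply, map_mul]; rfl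

/-- **The external tensor product `ω₁ ⊠ ω₂` of two representations on Schwartz spaces with continuous operators**:
`(g₁, g₂) ↦ ω₁ g₁ ⊠̂ ω₂ g₂`, the constructed operator tensor product on `𝓢(ℝ^{σ₁ ⊕ σ₂})`.
[cite: Weil1964, Chap. I n° 12–13, pp. 160–163] -/
def tensorRep (ω₁ : Representation ℂ G₁ (SR σ₁)) (hc₁ : ∀ g, Continuous (ω₁ g))
    (ω₂ : Representation ℂ G₂ (SR σ₂)) (hc₂ : ∀ g, Continuous (ω₂ g)) :
    Representation ℂ (G₁ × G₂) (SR (σ₁ ⊕ σ₂)) where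
  toFun g := ((tensorOp (repCLE ω₁ hc₁ g.1 : (SR σ₁) →L[ℂ] SR σ₁) (repCLE ω₂ hc₂ g.2 : (SR σ₂) →L[ℂ] SR σ₂) :
      (SR (σ₁ ⊕ σ₂)) →L[ℂ] SR (σ₁ ⊕ σ₂)) : (SR (σ₁ ⊕ σ₂)) →ₗ[ℂ] SR (σ₁ ⊕ σ₂))
  map_one' := by
    rw [Prod.fst_one, Prod.snd_one, coe_repCLE_one, coe_repCLE_one, tensorOp_id]
    rfl
  map_mul' g g' := by
    rw [Prod.fst_mul, Prod.snd_mul, coe_repCLE_mul, coe_repCLE_mul, ← tensorOp_comp]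
    rfl

variable (ω₁ : Representation ℂ G₁ (SR σ₁)) (hc₁ : ∀ g, Continuous (ω₁ g))
  (ω₂ : Representation ℂ G₂ (SR σ₂)) (hc₂ : ∀ g, Continuous (ω₂ g))

/-- Unfolding: `tensorRep … g = ω₁ g₁ ⊠̂ ω₂ g₂`. [folklore] -/
theorem tensorRep_apply (g : G₁ × G₂) (F : SR (σ₁ ⊕ σ₂)) :
    tensorRep ω₁ hc₁ ω₂ hc₂ g F =
      tensorOp (repCLE ω₁ hc₁ g.1 : (SR σ₁) →L[ℂ] SR σ₁) (repCLE ω₂ hc₂ g.2 : (SR σ₂) →L[ℂ] SR σ₂) F := rfl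

/-- the operators of `tensorRep` as continuous linear maps. [folklore] -/
theorem coe_tensorRep (g : G₁ × G₂) :
    (tensorRep ω₁ hc₁ ω₂ hc₂ g : (SR (σ₁ ⊕ σ₂)) →ₗ[ℂ] SR (σ₁ ⊕ σ₂)) =
      ((tensorOp (repCLE ω₁ hc₁ g.1 : (SR σ₁) →L[ℂ] SR σ₁) (repCLE ω₂ hc₂ g.2 : (SR σ₂) →L[ℂ] SR σ₂) :
        (SR (σ₁ ⊕ σ₂)) →L[ℂ] SR (σ₁ ⊕ σ₂)) : (SR (σ₁ ⊕ σ₂)) →ₗ[ℂ] SR (σ₁ ⊕ σ₂)) := rfl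

/-- **The operators of `ω₁ ⊠ ω₂` are continuous.** [folklore] -/
theorem continuous_tensorRep (g : G₁ × G₂) : Continuous (tensorRep ω₁ hc₁ ω₂ hc₂ g) :=
  (tensorOp _ _).continuous

/-- **Exact factorisation on pure tensors**: `ω(g₁, g₂) (Φ₁ ⊠ Φ₂) = ω₁ g₁ Φ₁ ⊠ ω₂ g₂ Φ₂`.
[cite: Weil1964, Chap. I n° 12, p. 160; Folland1989, §1.7] -/
theorem tensorRep_apply_tensorPi (g : G₁ × G₂) (Φ₁ : SR σ₁) (Φ₂ : SR σ₂) :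
    tensorRep ω₁ hc₁ ω₂ hc₂ g (tensorPi Φ₁ Φ₂) = tensorPi (ω₁ g.1 Φ₁) (ω₂ g.2 Φ₂) :=
  tensorOp_tensorPi _ _ Φ₁ Φ₂

/-! ## §3 (w2) Heisenberg covariance over the block sum -/

variable {ω₁ hc₁ ω₂ hc₂}

/-- **Covariance of `ω₁ ⊠ ω₂`**: if `ω_j` is Heisenberg-covariant over `ι𝕎_j` then `ω₁ ⊠ ω₂` is Heisenberg-covariant
over `spBlock ∘ (ι𝕎₁ × ι𝕎₂)`. [cite: Folland1989, §4.2, (4.23); Weil1964, Chap. I n° 12, p. 160] -/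
theorem isPhaseCovariantS_tensorRep {ι𝕎₁ : G₁ →* SpR σ₁} {ι𝕎₂ : G₂ →* SpR σ₂}
    (h₁ : IsPhaseCovariantS (fun g => ⇑((ι𝕎₁ g).1 : (PV σ₁) ≃ₗ[ℝ] PV σ₁)) (fun g => ω₁ g))
    (h₂ : IsPhaseCovariantS (fun g => ⇑((ι𝕎₂ g).1 : (PV σ₂) ≃ₗ[ℝ] PV σ₂)) (fun g => ω₂ g)) :
    IsPhaseCovariantS
      (fun g : G₁ × G₂ => ⇑((spBlock.comp (ι𝕎₁.prodMap ι𝕎₂) g).1 : (PV (σ₁ ⊕ σ₂)) ≃ₗ[ℝ] PV (σ₁ ⊕ σ₂)))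
      (fun g => tensorRep ω₁ hc₁ ω₂ hc₂ g) := by
  intro g p q F
  exact tensorOp_rhoS (s₁ := ⇑((ι𝕎₁ g.1).1 : (PV σ₁) ≃ₗ[ℝ] PV σ₁)) (s₂ := ⇑((ι𝕎₂ g.2).1 : (PV σ₂) ≃ₗ[ℝ] PV σ₂))
    _ _ (fun p q f => h₁ g.1 p q f) (fun p q f => h₂ g.2 p q f) p q F

/-! ## §4 (w2′) Unitarity -/

omit [DecidableEq σ₁] in
/-- `⟪toL2 u, toL2 v⟫ = ∫ ⟪u x, v x⟫`. [folklore] -/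
theorem inner_toL2_eq_integral {σ : Type*} [Fintype σ] (u v : SR σ) :
    ⟪toL2 u, toL2 v⟫_ℂ = ∫ x, ⟪u x, v x⟫_ℂ := by
  rw [MeasureTheory.L2.inner_def]
  refine integral_congr_ae ?_
  filter_upwards [coeFn_toL2 u, coeFn_toL2 v] with x hu hv
  rw [hu, hv]

omit [DecidableEq σ₁] [DecidableEq σ₂] in
/-- **`⟪f ⊠ g, f' ⊠ g'⟫_{L²} = ⟪f, f'⟫_{L²} ⟪g, g'⟫_{L²}`** (Fubini). [cite: Folland1989, Prop. (1.43)] -/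
theorem inner_toL2_tensorPi (f f' : SR σ₁) (g g' : SR σ₂) :
    ⟪toL2 (tensorPi f g), toL2 (tensorPi f' g')⟫_ℂ = ⟪toL2 f, toL2 f'⟫_ℂ * ⟪toL2 g, toL2 g'⟫_ℂ := by
  rw [inner_toL2_eq_integral, inner_toL2_eq_integral, inner_toL2_eq_integral,
    ← integral_mul_comp_inl_inr (fun y => ⟪f y, f' y⟫_ℂ) (fun z => ⟪g z, g' z⟫_ℂ)]
  refine integral_congr_ae (Filter.Eventually.of_forall fun x => ?_)
  simp only [tensorPi_apply, RCLike.inner_apply, map_mul]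
  ring

variable {A₁ : (SR σ₁) →L[ℂ] SR σ₁} {A₂ : (SR σ₂) →L[ℂ] SR σ₂}

/-- **Isometry of `A₁ ⊠̂ A₂` on pure tensors** when the factors are restrictions of unitaries. [cite: Folland1989, Prop. (1.43)] -/
theorem inner_toL2_tensorOp_tensorPi
    (hA₁ : ∃ U : (L2R σ₁) ≃ₗᵢ[ℂ] L2R σ₁,
      LiftsTo (A₁ : (SR σ₁) →ₗ[ℂ] SR σ₁) ((U.toContinuousLinearEquiv : (L2R σ₁) ≃L[ℂ] L2R σ₁) : (L2R σ₁) →L[ℂ] L2R σ₁))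
    (hA₂ : ∃ U : (L2R σ₂) ≃ₗᵢ[ℂ] L2R σ₂,
      LiftsTo (A₂ : (SR σ₂) →ₗ[ℂ] SR σ₂) ((U.toContinuousLinearEquiv : (L2R σ₂) ≃L[ℂ] L2R σ₂) : (L2R σ₂) →L[ℂ] L2R σ₂))
    (f f' : SR σ₁) (g g' : SR σ₂) :
    ⟪toL2 (tensorOp A₁ A₂ (tensorPi f g)), toL2 (tensorOp A₁ A₂ (tensorPi f' g'))⟫_ℂ =
      ⟪toL2 (tensorPi f g), toL2 (tensorPi f' g')⟫_ℂ := by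
  obtain ⟨U₁, hU₁⟩ := hA₁
  obtain ⟨U₂, hU₂⟩ := hA₂
  have e₁ : ∀ u : SR σ₁, toL2 (A₁ u) = U₁ (toL2 u) := fun u => hU₁ u
  have e₂ : ∀ u : SR σ₂, toL2 (A₂ u) = U₂ (toL2 u) := fun u => hU₂ u
  rw [tensorOp_tensorPi, tensorOp_tensorPi, inner_toL2_tensorPi, inner_toL2_tensorPi, e₁, e₁, e₂, e₂,
    LinearIsometryEquiv.inner_map_map, LinearIsometryEquiv.inner_map_map]

/-- **`A₁ ⊠̂ A₂` is `L²`-isometric on `𝓢(ℝ^{σ₁ ⊕ σ₂})`** when the factors are restrictions of unitaries: two density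
passes over pure tensors (`clm_eq_of_eq_on_tensorPi`). [cite: Folland1989, Prop. (1.43), §1.7] -/
theorem inner_toL2_tensorOp
    (hA₁ : ∃ U : (L2R σ₁) ≃ₗᵢ[ℂ] L2R σ₁,
      LiftsTo (A₁ : (SR σ₁) →ₗ[ℂ] SR σ₁) ((U.toContinuousLinearEquiv : (L2R σ₁) ≃L[ℂ] L2R σ₁) : (L2R σ₁) →L[ℂ] L2R σ₁))
    (hA₂ : ∃ U : (L2R σ₂) ≃ₗᵢ[ℂ] L2R σ₂,
      LiftsTo (A₂ : (SR σ₂) →ₗ[ℂ] SR σ₂) ((U.toContinuousLinearEquiv : (L2R σ₂) ≃L[ℂ] L2R σ₂) : (L2R σ₂) →L[ℂ] L2R σ₂))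
    (F G : SR (σ₁ ⊕ σ₂)) :
    ⟪toL2 (tensorOp A₁ A₂ F), toL2 (tensorOp A₁ A₂ G)⟫_ℂ = ⟪toL2 F, toL2 G⟫_ℂ := by
  -- first pass: the left slot a pure tensor, the right slot arbitrary
  have step1 : ∀ (f : SR σ₁) (g : SR σ₂) (G : SR (σ₁ ⊕ σ₂)),
      ⟪toL2 (tensorOp A₁ A₂ (tensorPi f g)), toL2 (tensorOp A₁ A₂ G)⟫_ℂ = ⟪toL2 (tensorPi f g), toL2 G⟫_ℂ := by
    intro f g G
    have h := clm_eq_of_eq_on_tensorPi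
      (S := (innerSL ℂ (toL2 (tensorOp A₁ A₂ (tensorPi f g)))).comp ((toL2).comp (tensorOp A₁ A₂)))
      (T := (innerSL ℂ (toL2 (tensorPi f g))).comp toL2) fun f' g' => by
        simp only [ContinuousLinearMap.comp_apply, innerSL_apply_apply]
        exact inner_toL2_tensorOp_tensorPi hA₁ hA₂ f f' g g'
    have hG := congrArg (fun L : (SR (σ₁ ⊕ σ₂)) →L[ℂ] ℂ => L G) h
    simpa only [ContinuousLinearMap.comp_apply, innerSL_apply_apply] using hG
  -- second pass: the left slot arbitrary
  have h := clm_eq_of_eq_on_tensorPi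
    (S := (innerSL ℂ (toL2 (tensorOp A₁ A₂ F))).comp ((toL2).comp (tensorOp A₁ A₂)))
    (T := (innerSL ℂ (toL2 F)).comp toL2) fun f' g' => by
      simp only [ContinuousLinearMap.comp_apply, innerSL_apply_apply]
      rw [← inner_conj_symm, step1 f' g' F, inner_conj_symm]
  have hG := congrArg (fun L : (SR (σ₁ ⊕ σ₂)) →L[ℂ] ℂ => L G) h
  simpa only [ContinuousLinearMap.comp_apply, innerSL_apply_apply] using hG

/-- **`‖(A₁ ⊠̂ A₂) F‖_{L²} = ‖F‖_{L²}`.** [cite: Folland1989, Prop. (1.43)] -/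
theorem norm_toL2_tensorOp
    (hA₁ : ∃ U : (L2R σ₁) ≃ₗᵢ[ℂ] L2R σ₁,
      LiftsTo (A₁ : (SR σ₁) →ₗ[ℂ] SR σ₁) ((U.toContinuousLinearEquiv : (L2R σ₁) ≃L[ℂ] L2R σ₁) : (L2R σ₁) →L[ℂ] L2R σ₁))
    (hA₂ : ∃ U : (L2R σ₂) ≃ₗᵢ[ℂ] L2R σ₂,
      LiftsTo (A₂ : (SR σ₂) →ₗ[ℂ] SR σ₂) ((U.toContinuousLinearEquiv : (L2R σ₂) ≃L[ℂ] L2R σ₂) : (L2R σ₂) →L[ℂ] L2R σ₂))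
    (F : SR (σ₁ ⊕ σ₂)) : ‖toL2 (tensorOp A₁ A₂ F)‖ = ‖toL2 F‖ := by
  rw [norm_eq_sqrt_re_inner (𝕜 := ℂ) (toL2 (tensorOp A₁ A₂ F)), norm_eq_sqrt_re_inner (𝕜 := ℂ) (toL2 F),
    inner_toL2_tensorOp hA₁ hA₂]

/-- **An `L²`-isometric continuous automorphism of `𝓢(ℝ^σ)` is the restriction of a unitary operator of `L²(ℝ^σ)`**
(extension along the dense embedding `toL2`, Mathlib's `LinearEquiv.extendOfIsometry`). [folklore] -/
theorem exists_unitary_liftsTo {σ : Type*} [Fintype σ] (T : (SR σ) ≃L[ℂ] SR σ)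
    (hT : ∀ F : SR σ, ‖toL2 (T F)‖ = ‖toL2 F‖) :
    ∃ U : (L2R σ) ≃ₗᵢ[ℂ] L2R σ,
      LiftsTo ((T : (SR σ) →L[ℂ] SR σ) : (SR σ) →ₗ[ℂ] SR σ)
        ((U.toContinuousLinearEquiv : (L2R σ) ≃L[ℂ] L2R σ) : (L2R σ) →L[ℂ] L2R σ) := by
  have hd : DenseRange (((toL2 : (SR σ) →L[ℂ] L2R σ) : (SR σ) →ₗ[ℂ] L2R σ)) := denseRange_toL2
  have hn : ∀ F : SR σ, ‖((toL2 : (SR σ) →L[ℂ] L2R σ) : (SR σ) →ₗ[ℂ] L2R σ) (T.toLinearEquiv F)‖ =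
      ‖((toL2 : (SR σ) →L[ℂ] L2R σ) : (SR σ) →ₗ[ℂ] L2R σ) F‖ := fun F => hT F
  refine ⟨T.toLinearEquiv.extendOfIsometry _ _ hd hd hn, fun F => ?_⟩
  exact (LinearEquiv.extendOfIsometry_eq T.toLinearEquiv _ _ hd hd hn F).symm

variable (ω₁ hc₁ ω₂ hc₂)

/-- **(w2′) for `ω₁ ⊠ ω₂`**: if every `ω₁ g₁` and every `ω₂ g₂` is the restriction of a unitary, so is every
`(ω₁ ⊠ ω₂)(g₁, g₂)`. [cite: Weil1964, Chap. I n° 12, p. 160; Folland1989, Prop. (1.43)] -/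
theorem exists_lift_tensorRep
    (hu₁ : ∀ g, ∃ U : (L2R σ₁) ≃ₗᵢ[ℂ] L2R σ₁,
      LiftsTo (ω₁ g) ((U.toContinuousLinearEquiv : (L2R σ₁) ≃L[ℂ] L2R σ₁) : (L2R σ₁) →L[ℂ] L2R σ₁))
    (hu₂ : ∀ g, ∃ U : (L2R σ₂) ≃ₗᵢ[ℂ] L2R σ₂,
      LiftsTo (ω₂ g) ((U.toContinuousLinearEquiv : (L2R σ₂) ≃L[ℂ] L2R σ₂) : (L2R σ₂) →L[ℂ] L2R σ₂))
    (g : G₁ × G₂) :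
    ∃ U : (L2R (σ₁ ⊕ σ₂)) ≃ₗᵢ[ℂ] L2R (σ₁ ⊕ σ₂),
      LiftsTo (tensorRep ω₁ hc₁ ω₂ hc₂ g)
        ((U.toContinuousLinearEquiv : (L2R (σ₁ ⊕ σ₂)) ≃L[ℂ] L2R (σ₁ ⊕ σ₂)) : (L2R (σ₁ ⊕ σ₂)) →L[ℂ] L2R (σ₁ ⊕ σ₂)) :=
  exists_unitary_liftsTo (repCLE (tensorRep ω₁ hc₁ ω₂ hc₂) (continuous_tensorRep ω₁ hc₁ ω₂ hc₂) g) fun F =>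
    norm_toL2_tensorOp (hu₁ g.1) (hu₂ g.2) F

/-! ## §5 The tensor product datum -/

/-- **The external tensor product of two archimedean Weil data is an archimedean Weil datum over the block sum**,
given (w1) for the product: (w2) is `isPhaseCovariantS_tensorRep`, (w2′) is `exists_lift_tensorRep`; the strong
continuity (w1) of `g ↦ (ω₁ ⊠ ω₂)(g) F` is the hypothesis `h1` (discharged in `IsArchWeilDatum.tensor` below).
[cite: Weil1964, Chap. I n° 12–13, pp. 160–163; Folland1989, Prop. (1.43), (4.23)] -/
theorem IsArchWeilDatum.tensor_of_continuous [TopologicalSpace G₁] [TopologicalSpace G₂]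
    {ι𝕎₁ : G₁ →* SpR σ₁} {ι𝕎₂ : G₂ →* SpR σ₂}
    (hW₁ : IsArchWeilDatum ι𝕎₁ ω₁) (hW₂ : IsArchWeilDatum ι𝕎₂ ω₂)
    (h1 : ∀ F : SR (σ₁ ⊕ σ₂), Continuous fun g : G₁ × G₂ => tensorRep ω₁ hc₁ ω₂ hc₂ g F) :
    IsArchWeilDatum (spBlock.comp (ι𝕎₁.prodMap ι𝕎₂)) (tensorRep ω₁ hc₁ ω₂ hc₂) where
  continuous_apply := h1
  covariant := isPhaseCovariantS_tensorRep hW₁.covariant hW₂.covariant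
  exists_lift := exists_lift_tensorRep ω₁ hc₁ ω₂ hc₂ hW₁.exists_lift hW₂.exists_lift

/-- **The external tensor product of two archimedean Weil data is an archimedean Weil datum over the block
sum**, for locally compact parameter groups (e.g. real points of algebraic groups): (w1) is
`Literature.Analysis.SegalBargmann.continuous_tensorOp_apply` (`SchwartzTensorStrongContinuity`) applied to the
operator families `repCLE ωⱼ hcⱼ`, (w2) is `isPhaseCovariantS_tensorRep`, (w2′) is `exists_lift_tensorRep`.
[cite: Weil1964, Chap. I n° 12–13, pp. 160–163, Chap. III n° 37–38, pp. 188–190; Folland1989, Prop. (1.43), (4.23)] -/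
theorem IsArchWeilDatum.tensor [TopologicalSpace G₁] [TopologicalSpace G₂]
    [LocallyCompactSpace G₁] [LocallyCompactSpace G₂]
    {ι𝕎₁ : G₁ →* SpR σ₁} {ι𝕎₂ : G₂ →* SpR σ₂}
    (hW₁ : IsArchWeilDatum ι𝕎₁ ω₁) (hW₂ : IsArchWeilDatum ι𝕎₂ ω₂) :
    IsArchWeilDatum (spBlock.comp (ι𝕎₁.prodMap ι𝕎₂)) (tensorRep ω₁ hc₁ ω₂ hc₂) :=
  IsArchWeilDatum.tensor_of_continuous ω₁ hc₁ ω₂ hc₂ hW₁ hW₂ fun F =>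
    Literature.Analysis.SegalBargmann.continuous_tensorOp_apply
      (fun g => (repCLE ω₁ hc₁ g : (SR σ₁) →L[ℂ] SR σ₁)) (fun g => (repCLE ω₂ hc₂ g : (SR σ₂) →L[ℂ] SR σ₂))
      hW₁.continuous_apply hW₂.continuous_apply F

end TensorRep

/-!
Used: Mathlib `LinearEquiv.extendOfIsometry`, `MeasureTheory.L2.inner_def`, `LinearIsometryEquiv.inner_map_map`,
`innerSL`; tree `tensorOp`, `tensorOp_tensorPi`, `tensorOp_id`, `tensorOp_comp`, `tensorOp_rhoS`,
`clm_eq_of_eq_on_tensorPi`, `integral_mul_comp_inl_inr`, `UnitaryGroup.spSumHom`, `repCLE`, `denseRange_toL2`;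
(w1) imported: `Literature.Analysis.SegalBargmann.continuous_tensorOp_apply` (`SchwartzTensorStrongContinuity`).
Not available and worked around: none.
-/

end Literature.NumberTheory.Weil1964

end
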